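import Summits.Ventures.HSemireg.WedgeHankelRecurrenceGaussDiscriminantAffine

/-!
# Venture HSemireg — **COMMON ZEROS TWO STEPS APART IN A SYMMETRIC RECURRENCE**: for `a ≡ 0` one has `q_{2m+1}(0) = 0` and `q_{2m}(0) = (−1)^m b_1 b_3 ⋯ b_{2m−1}` (any commutative ring),
# so by N421 (`q_{n+2}`, `q_n` share a zero iff `q_n(a_{n+1}) = 0`) a positive symmetric recurrence has **`q_{n+2}` and `q_n` with a common zero iff `n` is odd** (the zero `0`); in particular
# **`He_{n+2}` and `He_n` have a common real zero iff `n` is odd** (Hermite, `b_k = k`), and likewise for every Gegenbauer ∕ Legendre ∕ Chebyshev family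

HONEST FRAMING. Part of the Lean index of the computation cell `pub-hsemireg` (seat p10 gen 47, Sunday typer «UNIFORM-IN-n»).  Polynomial algebra and the real recurrence only; no variety, no
cohomology theory, no sheaf, no Ext group and no semiregularity map is constructed here; nothing here says that HC / HC_CM / HC_AV holds; no Literature fact (unproved `Prop`) is declared or used.
Custodian versions as in `WedgeHankelSiegelIdeal` (1/3).
SOURCES (cited).  G. Szegő, *Orthogonal Polynomials*, (4.7.4) ∕ (5.5.5) (parity, values at `0`); P. C. Gibson, J. Approx. Theory 105 (2000) 129–132 (common zeros of `p_n`, `p_{n−2}`); K. Driver,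
M. E. Muldoon, *Common and interlacing zeros of families of Laguerre polynomials*, J. Approx. Theory 193 (2015) 89–98 (the phenomenon for classical families).  The parity criterion is the
COROLLARY typed here of N421.
PROOF TYPED HERE.  Two-step induction for `q_n(0)` with `a ≡ 0`; N421 `common_zero_gap_two_iff`; Hermite through N359 `hermite_eq_recurrence` ∕ N3xx `recurrence_of_coefficients`.
DEDUP DISCLOSURE (`rg -n -i 'eval_zero_odd|eval_zero_even|common_zero' Summits/Ventures/HSemireg/WedgeHankelRecurrenceGauss*`, 2026-09-04): N421 (general criterion), N373 (`(−1)^n q_n(0)` for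
birth–death data); 0 hits for the 4 names below.

WHAT IS IN THE TREE.  N421 `common_zero_gap_two_iff`; N359 `hermite_eq_recurrence`; N3xx `recurrence_of_coefficients`.
THIS FILE (namespace `Summit.Ventures.HSemireg.Wedge.HankelOuter` continued; CHAINED on N426 (import only); 0 definitions):
* §1192 `recurrence_eval_zero_of_diag_zero` (`q_{2m+1}(0) = 0`, `q_{2m}(0) = (−1)^m ∏_{k<m} b_{2k+1}`), **`common_zero_gap_two_iff_odd`** (`a ≡ 0`, `b > 0`),
  **`hermite_common_zero_gap_two_iff_odd`**.
CAVEATS.  Real positive recurrences for the «iff» (complex common zeros are excluded anyway by N421's coprimality criterion over any field).  Nothing Ext-side.  New names only.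
-/

open Module Polynomial
open scoped Matrix Polynomial

namespace Summit.Ventures.HSemireg.Wedge.HankelOuter

/-! ## §1192. `q_n(0)` for a symmetric recurrence; common zeros iff `n` odd -/

/-- **`a ≡ 0` ⇒ `q_{2m+1}(0) = 0` and `q_{2m}(0) = (−1)^m ∏_{k<m} b_{2k+1}`** (any commutative ring). [Szegő (4.7.4), (5.5.5); this file, §1192] -/
theorem recurrence_eval_zero_of_diag_zero {R : Type*} [CommRing R] {q : ℕ → R[X]} {a b : ℕ → R} (hq0 : q 0 = 1) (hq1 : q 1 = Polynomial.X - C (a 0))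
    (hrec : ∀ n, q (n + 2) = (Polynomial.X - C (a (n + 1))) * q (n + 1) - C (b (n + 1)) * q n) (ha : ∀ n, a n = 0) (m : ℕ) :
    (q (2 * m + 1)).eval 0 = 0 ∧ (q (2 * m)).eval 0 = (-1) ^ m * ∏ k ∈ Finset.range m, b (2 * k + 1) := by
  induction m with
  | zero =>
    refine ⟨?_, by rw [Nat.mul_zero, hq0, eval_one, pow_zero, Finset.prod_range_zero, mul_one]⟩
    rw [Nat.mul_zero, zero_add, hq1, ha, eval_sub, eval_X, eval_C, sub_zero]
  | succ m ih =>
    obtain ⟨ho, he⟩ := ih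
    have he' : (q (2 * m + 2)).eval 0 = (-1) ^ (m + 1) * ∏ k ∈ Finset.range (m + 1), b (2 * k + 1) := by
      rw [hrec (2 * m), ha, eval_sub, eval_mul, eval_sub, eval_X, eval_C, sub_zero, zero_mul, zero_sub, eval_mul, eval_C, he, Finset.prod_range_succ, pow_succ]
      ring
    refine ⟨?_, by rw [show 2 * (m + 1) = 2 * m + 2 by ring]; exact he'⟩
    rw [show 2 * (m + 1) + 1 = (2 * m + 1) + 2 by ring, hrec (2 * m + 1), ha, eval_sub, eval_mul, eval_sub, eval_X, eval_C, sub_zero, zero_mul, zero_sub, eval_mul, eval_C,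
      show 2 * m + 1 + 1 = 2 * m + 2 from rfl]
    rw [ho, mul_zero, neg_zero]

/-- **SYMMETRIC POSITIVE RECURRENCE: `q_{n+2}` and `q_n` have a common zero iff `n` is odd** (the common zero is `0`). [corollary of N421 + parity; Gibson 2000; this file, §1192] -/
theorem common_zero_gap_two_iff_odd {q : ℕ → ℝ[X]} {a b : ℕ → ℝ} (hq0 : q 0 = 1) (hq1 : q 1 = Polynomial.X - C (a 0))
    (hrec : ∀ n, q (n + 2) = (Polynomial.X - C (a (n + 1))) * q (n + 1) - C (b (n + 1)) * q n) (ha : ∀ n, a n = 0) (hb : ∀ j, 0 < b j) (n : ℕ) :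
    (∃ s, (q (n + 2)).eval s = 0 ∧ (q n).eval s = 0) ↔ Odd n := by
  rw [common_zero_gap_two_iff hq0 hq1 hrec hb n, ha]
  obtain ⟨m, rfl | rfl⟩ := Nat.even_or_odd' n
  · rw [(recurrence_eval_zero_of_diag_zero hq0 hq1 hrec ha m).2]
    constructor
    · intro h
      exact absurd h (mul_ne_zero (pow_ne_zero _ (by norm_num)) (Finset.prod_ne_zero_iff.2 fun k _ => (hb _).ne'))
    · rintro ⟨k, hk⟩; omega
  · rw [(recurrence_eval_zero_of_diag_zero hq0 hq1 hrec ha m).1]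
    exact ⟨fun _ => ⟨m, rfl⟩, fun _ => rfl⟩

/-- **HERMITE: `He_{n+2}` and `He_n` have a common real zero iff `n` is odd.** [corollary; Szegő (5.5.5); Driver–Muldoon 2015 (phenomenon); this file, §1192] -/
theorem hermite_common_zero_gap_two_iff_odd (n : ℕ) :
    (∃ s : ℝ, ((Polynomial.hermite (n + 2)).map (Int.castRingHom ℝ)).eval s = 0 ∧ ((Polynomial.hermite n).map (Int.castRingHom ℝ)).eval s = 0) ↔ Odd n := by
  obtain ⟨q, hq0, hq1, hrec⟩ := recurrence_of_coefficients (fun _ => (0 : ℝ)) (fun j => ((max j 1 : ℕ) : ℝ))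
  have hb1 : ∀ m : ℕ, (fun j => ((max j 1 : ℕ) : ℝ)) (m + 1) = (m : ℝ) + 1 := fun m => by
    simp only [show max (m + 1) 1 = m + 1 from max_eq_left (Nat.le_add_left 1 m), Nat.cast_add, Nat.cast_one]
  have hq := hermite_eq_recurrence (q := q) (a := fun _ => (0 : ℝ)) (b := fun j => ((max j 1 : ℕ) : ℝ)) hq0 hq1 hrec (fun _ => rfl) hb1
  rw [← hq (n + 2), ← hq n]
  exact common_zero_gap_two_iff_odd (q := q) (a := fun _ => (0 : ℝ)) (b := fun j => ((max j 1 : ℕ) : ℝ)) hq0 hq1 hrec (fun _ => rfl) (fun j => by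
    show (0 : ℝ) < ((max j 1 : ℕ) : ℝ)
    exact_mod_cast lt_of_lt_of_le Nat.one_pos (le_max_right j 1)) n

end Summit.Ventures.HSemireg.Wedge.HankelOuter
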